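import Mathlib
import HarnessLib

/-!
# `WakeRatchet.TailRatchet` (stmt-NavierStokesRegularity-21808): the drain-free front equation for time ratio
# `s > 2` — every solution with `b(0) > 0` vanishes within `|t| ≤ s³/(4(s−2)b(0))` (census item G0(iii))

Support file for the crux `TailRatchet` (route `WakeRatchet`; MODEL lattice ODEs of Tao 2016 §1.2, §4 — nothing
in this file is a statement about the Navier–Stokes equations, and no item is closed here).

Context (census of stmt-21808, continuation programme "R-glob" of exact scalar dyadic DSS fronts; step G0 «drain-free
rigidity»).  The branch of admissible fronts of `b' = (4/s²)b(t/s)² − 4sδ·b(t)b(st)` emanates from the relay point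
`(s, δ) = (2, 0)` (`…RelayFront`, `…LacunaryFrontAll`); its continuation to `δ → 1⁻` (`Λ → 1⁺`) must rule out a return
to the drain-free axis `δ = 0` at a time ratio `s ≠ 2`.  The drain-free equation `b' = (4/s²) b(t/s)²` is an
initial-value problem at `0⁻` (`…RelayDrainFreeUnique`); this file settles the half `s > 2` of the numerical record of
that file ANALYTICALLY:

* `barrier` — if `s > 2` and a solution is positive on `[T, 0]`, then `4(s−2)·b(0)·|T| < s³`;
* `exists_nonpos` — hence every solution with `b(0) > 0` has a zero `t ∈ [−s³/(4(s−2)b(0)), 0)`, so it is NOT an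
  admissible (positive, integrable) front.

THE ARGUMENT (elementary, new here).  With `ℓ = log b` and the «doubling defect» `D(t) = 2ℓ(t/s) − ℓ(t)` one has
`ℓ' = (4/s²)e^{D}` and `D'(t) = (4/s²)[(2/s)e^{D(t/s)} − e^{D(t)}]`.  For `s > 2`, `D'(0⁻) < 0`, and a largest point
with `D' ≥ 0` cannot exist (there `D(t/s) < D(t)` already forces `D' < 0`): so `D` is strictly decreasing, whence
`D' ≤ −κe^{D}` with `κ = 4(s−2)/s³`, i.e. `(e^{−D})' ≥ κ`; since `e^{−D(0)} = 1/b(0)` and `e^{−D} > 0`, positivity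
cannot persist beyond `|T| = 1/(κ b(0))`.  (Numerical record of `…RelayDrainFreeUnique`: first zeros at
`|t| ≈ 4.8, 3.5, 3.9, 5.7` for `s = 2.05, 2.5, 3, 4`, against the bounds `43.1, 7.8, 6.75, 8`.)

HONEST FRAMING: elementary real analysis of a MODEL functional ODE; the construction item and the crux stay open;
nothing here concerns Navier–Stokes.
-/

noncomputable section

set_option linter.dupNamespace false

namespace Summit.NavierStokesRegularity.NavierStokesRegularity.Theorems

namespace WakeRatchetRelayDrainFreeSignChange

open Set Filter Topology

variable {s : ℝ} {b : ℝ → ℝ}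

/-- `e^{2 log x − log y} = x²/y` for positive `x, y`. [folklore] -/
theorem exp_two_log_sub_log {x y : ℝ} (hx : 0 < x) (hy : 0 < y) :
    Real.exp (2 * Real.log x - Real.log y) = x ^ 2 / y := by
  rw [Real.exp_sub, Real.exp_log hy, show 2 * Real.log x = Real.log x + Real.log x by ring, Real.exp_add,
    Real.exp_log hx, sq]

/-- For `t ≤ 0` and `s ≥ 1`: `t ≤ t/s ≤ 0`. [folklore] -/
theorem div_mem_of_nonpos (hs : 1 ≤ s) {t : ℝ} (ht : t ≤ 0) : t ≤ t / s ∧ t / s ≤ 0 := by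
  have hs0 : 0 < s := by linarith
  refine ⟨?_, div_nonpos_of_nonpos_of_nonneg ht hs0.le⟩
  rw [le_div_iff₀ hs0]
  nlinarith

/-- For `t < 0` and `s > 1`: `t < t/s`. [folklore] -/
theorem lt_div_of_neg (hs : 1 < s) {t : ℝ} (ht : t < 0) : t < t / s := by
  have hs0 : 0 < s := by linarith
  rw [lt_div_iff₀ hs0]
  nlinarith

/-- **Log-derivative of a positive drain-free solution**: `(log b)'(t) = (4/s²) e^{D(t)}` with
`D(t) = 2 log b(t/s) − log b(t)`. [folklore] -/
theorem hasDerivAt_log (hd : ∀ t : ℝ, t < 0 → HasDerivAt b (4 / s ^ 2 * b (t / s) ^ 2) t)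
    {t : ℝ} (ht : t < 0) (hbt : 0 < b t) (hbs : 0 < b (t / s)) :
    HasDerivAt (fun x => Real.log (b x))
      (4 / s ^ 2 * Real.exp (2 * Real.log (b (t / s)) - Real.log (b t))) t := by
  have h := (hd t ht).log hbt.ne'
  refine h.congr_deriv ?_
  rw [exp_two_log_sub_log hbs hbt]
  ring

/-- **Derivative of the doubling defect** `D(t) = 2 log b(t/s) − log b(t)`:
`D'(t) = (4/s²)[(2/s) e^{D(t/s)} − e^{D(t)}]`. [folklore] -/
theorem hasDerivAt_defect (hd : ∀ t : ℝ, t < 0 → HasDerivAt b (4 / s ^ 2 * b (t / s) ^ 2) t)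
    (hs : 1 < s) {t : ℝ} (ht : t < 0) (hbt : 0 < b t) (hbs : 0 < b (t / s)) (hbss : 0 < b (t / s / s)) :
    HasDerivAt (fun x => 2 * Real.log (b (x / s)) - Real.log (b x))
      (4 / s ^ 2 * (2 / s * Real.exp (2 * Real.log (b (t / s / s)) - Real.log (b (t / s)))
        - Real.exp (2 * Real.log (b (t / s)) - Real.log (b t)))) t := by
  have hs0 : 0 < s := by linarith
  have hts : t / s < 0 := div_neg_of_neg_of_pos ht hs0
  have h1 : HasDerivAt (fun x => Real.log (b x))
      (4 / s ^ 2 * Real.exp (2 * Real.log (b (t / s / s)) - Real.log (b (t / s)))) (t / s) :=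
    hasDerivAt_log hd hts hbs hbss
  have h2 : HasDerivAt (fun x : ℝ => x / s) (1 / s) t := (hasDerivAt_id t).div_const s
  have h3 := h1.comp t h2
  have h3' : HasDerivAt (fun x => Real.log (b (x / s)))
      (4 / s ^ 2 * Real.exp (2 * Real.log (b (t / s / s)) - Real.log (b (t / s))) * (1 / s)) t := h3
  have h4 := (h3'.const_mul 2).sub (hasDerivAt_log hd ht hbt hbs)
  refine h4.congr_deriv ?_
  field_simp

/-- **The barrier (s > 2).**  If `s > 2` and a solution of the drain-free front equation
`b' = (4/s²) b(t/s)²` (`t < 0`), continuous on `(−∞,0]`, is positive on `[T, 0]` (`T ≤ 0`), then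
`4(s−2)·b(0)·|T| < s³`.
[cite: Tao2016AveragedNS, §1.2 (dyadic model); cell vocabulary (drain-free scalar front equation of `DyadicScalarFronts`, census item G0 of stmt-21808)] -/
theorem barrier (hs : 2 < s) (hc : ContinuousOn b (Iic 0))
    (hd : ∀ t : ℝ, t < 0 → HasDerivAt b (4 / s ^ 2 * b (t / s) ^ 2) t)
    {T : ℝ} (hT : T ≤ 0) (hpos : ∀ t ∈ Icc T 0, 0 < b t) :
    4 * (s - 2) * b 0 * (-T) < s ^ 3 := by
  have hs0 : 0 < s := by linarith
  have hs1 : 1 < s := by linarith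
  have hs1' : (1 : ℝ) ≤ s := hs1.le
  -- the defect, its derivative and continuity data
  set D : ℝ → ℝ := fun x => 2 * Real.log (b (x / s)) - Real.log (b x) with hD
  set G : ℝ → ℝ := fun x => 4 / s ^ 2 * (2 / s * Real.exp (D (x / s)) - Real.exp (D x)) with hG
  have hmem : ∀ t ∈ Icc T 0, t / s ∈ Icc T 0 := fun t ht =>
    ⟨ht.1.trans (div_mem_of_nonpos hs1' ht.2).1, (div_mem_of_nonpos hs1' ht.2).2⟩
  have hD' : ∀ t ∈ Ico T 0, HasDerivAt D (G t) t := by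
    intro t ht
    have h1 := hmem t ⟨ht.1, ht.2.le⟩
    have h2 := hmem (t / s) h1
    exact hasDerivAt_defect hd hs1 ht.2 (hpos t ⟨ht.1, ht.2.le⟩) (hpos _ h1) (hpos _ h2)
  have hlogc : ContinuousOn (fun x => Real.log (b x)) (Icc T 0) :=
    (hc.mono fun x hx => hx.2).log fun x hx => (hpos x hx).ne'
  have hlogsc : ContinuousOn (fun x => Real.log (b (x / s))) (Icc T 0) :=
    hlogc.comp (continuousOn_id.div_const s) fun x hx => hmem x hx
  have hDc : ContinuousOn D (Icc T 0) := (hlogsc.const_smul (2 : ℝ)).sub hlogc |>.congr fun x _ => by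
    simp [hD, smul_eq_mul]
  have hDsc : ContinuousOn (fun x => D (x / s)) (Icc T 0) :=
    hDc.comp (continuousOn_id.div_const s) fun x hx => hmem x hx
  have hGc : ContinuousOn G (Icc T 0) := by
    have h1 : ContinuousOn (fun x => Real.exp (D (x / s))) (Icc T 0) :=
      Real.continuous_exp.comp_continuousOn hDsc
    have h2 : ContinuousOn (fun x => Real.exp (D x)) (Icc T 0) :=
      Real.continuous_exp.comp_continuousOn hDc
    exact ((h1.const_smul (2 / s)).sub h2).const_smul (4 / s ^ 2) |>.congr fun x _ => by
      simp [hG, smul_eq_mul]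
  have h2s : 2 / s < 1 := by rw [div_lt_one hs0]; exact hs
  have h2s0 : 0 < 2 / s := by positivity
  -- `G(t) < 0` as soon as `D(t/s) < D(t)`
  have hGneg_of : ∀ t, D (t / s) < D t → G t < 0 := by
    intro t hlt
    have h1 : Real.exp (D (t / s)) < Real.exp (D t) := Real.exp_lt_exp.2 hlt
    have h2 : 2 / s * Real.exp (D (t / s)) < Real.exp (D t) := by
      calc 2 / s * Real.exp (D (t / s)) < 2 / s * Real.exp (D t) :=
            mul_lt_mul_of_pos_left h1 h2s0
        _ < 1 * Real.exp (D t) := mul_lt_mul_of_pos_right h2s (Real.exp_pos _)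
        _ = Real.exp (D t) := one_mul _
    have h3 : 0 < 4 / s ^ 2 := by positivity
    show 4 / s ^ 2 * (2 / s * Real.exp (D (t / s)) - Real.exp (D t)) < 0
    exact mul_neg_of_pos_of_neg h3 (by linarith)
  have hG0 : G 0 < 0 := by
    have : D (0 / s) = D 0 := by rw [zero_div]
    show 4 / s ^ 2 * (2 / s * Real.exp (D (0 / s)) - Real.exp (D 0)) < 0
    rw [this]
    have h3 : 0 < 4 / s ^ 2 := by positivity
    have h4 : 2 / s * Real.exp (D 0) < 1 * Real.exp (D 0) := mul_lt_mul_of_pos_right h2s (Real.exp_pos _)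
    exact mul_neg_of_pos_of_neg h3 (by linarith)
  -- strict decrease of `D` on `[τ, 0]` from `G < 0` on `(τ, 0)`
  have hanti_of : ∀ τ, T ≤ τ → (∀ t ∈ Ioo τ 0, G t < 0) → StrictAntiOn D (Icc τ 0) := by
    intro τ hτ hneg
    refine strictAntiOn_of_deriv_neg (convex_Icc τ 0) (hDc.mono (Icc_subset_Icc hτ le_rfl)) ?_
    intro x hx
    rw [interior_Icc] at hx
    rw [(hD' x ⟨hτ.trans hx.1.le, hx.2⟩).deriv]
    exact hneg x hx
  -- Step 1: `G < 0` on `[T, 0]`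
  have hGneg : ∀ t ∈ Icc T 0, G t < 0 := by
    by_contra hcon
    push Not at hcon
    obtain ⟨t₀, ht₀, hGt₀⟩ := hcon
    set Bad : Set ℝ := Icc T 0 ∩ G ⁻¹' Ici 0 with hBad
    have hBclosed : IsClosed Bad := hGc.preimage_isClosed_of_isClosed isClosed_Icc isClosed_Ici
    have hBne : Bad.Nonempty := ⟨t₀, ht₀, hGt₀⟩
    have hBbdd : BddAbove Bad := ⟨0, fun x hx => hx.1.2⟩
    set t₁ := sSup Bad with ht₁
    have ht₁mem : t₁ ∈ Bad := hBclosed.csSup_mem hBne hBbdd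
    have ht₁T : T ≤ t₁ := ht₁mem.1.1
    have ht₁0 : t₁ ≤ 0 := ht₁mem.1.2
    have hGt₁ : 0 ≤ G t₁ := ht₁mem.2
    have ht₁ne : t₁ ≠ 0 := fun h => by rw [h] at hGt₁; linarith
    have ht₁lt : t₁ < 0 := lt_of_le_of_ne ht₁0 ht₁ne
    have hafter : ∀ t ∈ Ioo t₁ 0, G t < 0 := by
      intro t ht
      by_contra h
      push Not at h
      have : t ≤ t₁ := le_csSup hBbdd ⟨⟨ht₁T.trans ht.1.le, ht.2.le⟩, h⟩
      linarith [ht.1]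
    have hanti := hanti_of t₁ ht₁T hafter
    have hlt : t₁ < t₁ / s := lt_div_of_neg hs1 ht₁lt
    have hmem₁ : t₁ / s ∈ Icc t₁ 0 := ⟨hlt.le, (div_mem_of_nonpos hs1' ht₁0).2⟩
    have hDlt : D (t₁ / s) < D t₁ := hanti ⟨le_rfl, ht₁0⟩ hmem₁ hlt
    linarith [hGneg_of t₁ hDlt]
  -- Step 2: `D` strictly decreasing on `[T, 0]`, so `D(t/s) < D(t)` for `T ≤ t < 0`
  have hanti : StrictAntiOn D (Icc T 0) := hanti_of T le_rfl fun t ht => hGneg t ⟨ht.1.le, ht.2.le⟩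
  have hDlt : ∀ t ∈ Ico T 0, D (t / s) < D t := fun t ht =>
    hanti ⟨ht.1, ht.2.le⟩ (hmem t ⟨ht.1, ht.2.le⟩) (lt_div_of_neg hs1 ht.2)
  -- Step 3: `E = e^{-D}` has derivative `≥ κ = (4/s²)(1 - 2/s)` on `(T, 0)`
  set κ : ℝ := 4 / s ^ 2 * (1 - 2 / s) with hκ
  set E : ℝ → ℝ := fun x => Real.exp (-D x) with hE
  have hE' : ∀ t ∈ Ico T 0, HasDerivAt E (Real.exp (-D t) * (-G t)) t := fun t ht =>
    (hD' t ht).neg.exp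
  have hE'ge : ∀ t ∈ Ico T 0, κ ≤ Real.exp (-D t) * (-G t) := by
    intro t ht
    have h1 : Real.exp (D (t / s) - D t) < 1 := by
      rw [Real.exp_lt_one_iff]; linarith [hDlt t ht]
    have hid : Real.exp (-D t) * (-G t) = 4 / s ^ 2 * (1 - 2 / s * Real.exp (D (t / s) - D t)) := by
      show Real.exp (-D t) * (-(4 / s ^ 2 * (2 / s * Real.exp (D (t / s)) - Real.exp (D t))))
        = 4 / s ^ 2 * (1 - 2 / s * Real.exp (D (t / s) - D t))
      have e1 : Real.exp (-D t) * Real.exp (D t) = 1 := by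
        rw [← Real.exp_add, neg_add_cancel, Real.exp_zero]
      have e2 : Real.exp (D (t / s) - D t) = Real.exp (D (t / s)) * Real.exp (-D t) := by
        rw [sub_eq_add_neg, Real.exp_add]
      rw [e2]
      linear_combination (4 / s ^ 2) * e1
    rw [hid, hκ]
    have h3 : 0 < 4 / s ^ 2 := by positivity
    refine mul_le_mul_of_nonneg_left ?_ h3.le
    nlinarith [Real.exp_pos (D (t / s) - D t)]
  have hEc : ContinuousOn E (Icc T 0) := Real.continuous_exp.comp_continuousOn hDc.neg
  have hEdiff : DifferentiableOn ℝ E (interior (Icc T 0)) := by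
    rw [interior_Icc]; intro x hx; exact (hE' x ⟨hx.1.le, hx.2⟩).differentiableAt.differentiableWithinAt
  have hEderiv : ∀ x ∈ interior (Icc T 0), κ ≤ deriv E x := by
    rw [interior_Icc]; intro x hx
    rw [(hE' x ⟨hx.1.le, hx.2⟩).deriv]
    exact hE'ge x ⟨hx.1.le, hx.2⟩
  have hMVT := (convex_Icc T 0).mul_sub_le_image_sub_of_le_deriv hEc hEdiff hEderiv T
    ⟨le_rfl, hT⟩ 0 ⟨hT, le_rfl⟩ hT
  -- `E 0 = 1/b 0`, `E T > 0`
  have hE0 : E 0 = (b 0)⁻¹ := by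
    show Real.exp (-(2 * Real.log (b (0 / s)) - Real.log (b 0))) = (b 0)⁻¹
    rw [zero_div, show -(2 * Real.log (b 0) - Real.log (b 0)) = -Real.log (b 0) by ring, Real.exp_neg,
      Real.exp_log (hpos 0 ⟨hT, le_rfl⟩)]
  have hET : 0 < E T := Real.exp_pos _
  have hb0 : 0 < b 0 := hpos 0 ⟨hT, le_rfl⟩
  have hkey : κ * (-T) < (b 0)⁻¹ := by
    have : κ * (0 - T) ≤ E 0 - E T := hMVT
    rw [hE0] at this
    linarith
  have hκ' : κ = 4 * (s - 2) / s ^ 3 := by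
    rw [hκ]; field_simp
  rw [hκ', div_mul_eq_mul_div, div_lt_iff₀ (by positivity)] at hkey
  calc 4 * (s - 2) * b 0 * (-T) = 4 * (s - 2) * (-T) * b 0 := by ring
    _ < (b 0)⁻¹ * s ^ 3 * b 0 := mul_lt_mul_of_pos_right hkey hb0
    _ = s ^ 3 := by field_simp

/-- **Sign change for `s > 2`.**  Every solution of the drain-free front equation with `s > 2`, continuous on
`(−∞,0]`, with `b(0) > 0`, is non-positive somewhere in `[−s³/(4(s−2)b(0)), 0)`; in particular it is not a
positive front.
[cite: Tao2016AveragedNS, §1.2 (dyadic model); cell vocabulary (drain-free scalar front equation of `DyadicScalarFronts`, census item G0 of stmt-21808)] -/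
theorem exists_nonpos (hs : 2 < s) (hc : ContinuousOn b (Iic 0))
    (hd : ∀ t : ℝ, t < 0 → HasDerivAt b (4 / s ^ 2 * b (t / s) ^ 2) t) (h0 : 0 < b 0) :
    ∃ t ∈ Ico (-(s ^ 3 / (4 * (s - 2) * b 0))) 0, b t ≤ 0 := by
  by_contra hcon
  push Not at hcon
  set T : ℝ := -(s ^ 3 / (4 * (s - 2) * b 0)) with hTdef
  have hs2 : 0 < s - 2 := by linarith
  have hT : T ≤ 0 := by rw [hTdef]; exact neg_nonpos.2 (by positivity)
  have hpos : ∀ t ∈ Icc T 0, 0 < b t := by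
    intro t ht
    rcases eq_or_lt_of_le ht.2 with h | h
    · rw [h]; exact h0
    · exact hcon t ⟨ht.1, h⟩
  have h := barrier hs hc hd hT hpos
  have : 4 * (s - 2) * b 0 * (-T) = s ^ 3 := by
    rw [hTdef, neg_neg]; field_simp
  linarith

end WakeRatchetRelayDrainFreeSignChange

end Summit.NavierStokesRegularity.NavierStokesRegularity.Theorems

end
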